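import Summits.ValiantsHypothesis.ValiantsHypothesis.Theorems.KPlusLogSqLawTropicalBFourFourOrderKit

/-!
# Route «KPlusLogSqLaw», crux `TropicalB` (stmt-ValiantsHypothesis-19771) — certificate kit for ORDER-TYPE LAWS of the `(4,4)` row, part 2:
# certificate soundness, the refutation search (with row relabelling), and table splitting

HONEST FRAMING.  The `m = 4` twin of `…ThreeFourOrderSearch` (cell `pub-symmetroid`, seat val-sym-trop-p5 g12, 2026-08-28; `--supports … --as
helper`): `cert_sound_four`, `refute`/`refute_sound`, `refute1`/`not_realised_of_refute1` verbatim at format `(4,4)`, plus §4 (`certFor_append(_left)`,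
`refute_mono`, `refute_cons_of_forall`, `refute1_of_refute`) to assemble a law from per-branch certificate tables kept in separate files.  No census
claim here; nothing on `TropicalB` in its window, `WeakLifting`, the doors, `MatrixDescartes` (stmt-18050) or VP ≠ VNP.  [folklore: LP duality; this cell]
-/

set_option linter.dupNamespace false
set_option autoImplicit false
namespace Summit.ValiantsHypothesis.ValiantsHypothesis.Theorems.KPlusLogSqLaw

namespace FourFourCore

open ThreeFourCore (form comb form_comb form_sub form_ite list_sum_comm)
open Summit.ValiantsHypothesis.ValiantsHypothesis.Theorems.MatrixDescartes.Negative
open Summit.ValiantsHypothesis.ValiantsHypothesis.Theorems.LacunarySymmetroidMatrixDescartes.TropicalCensus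
open Summit.ValiantsHypothesis.ValiantsHypothesis.Theorems.KPlusLogSqLaw.ConvexPosition
open Summit.ValiantsHypothesis.ValiantsHypothesis.Theorems.KPlusLogSqLaw.HingeLaw
open Finset
section CertSound
variable (d : Fin 4 → ℕ) (v ε : Fin 4 → Fin 4 → Fin 4 → ℤ)

/-- **soundness of a certificate** (Farkas / master-law argument, as at `(3,4)`). [folklore: Farkas; this cell] -/
theorem cert_sound_four (fut : List (ℤ × RT)) (hdom : ∀ f ∈ fut, IsDominant d v ε f.1 f.2)
    (hinc : fut.Pairwise (fun f g => f.1 < g.1)) (G : (Fin 4 → ℤ) × (Fin 4 → ℤ) × (Fin 4 → ℤ))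
    (hG1 : 0 ≤ form G.1 d) (hG2 : 0 ≤ form G.2.1 d) (hG3 : 0 ≤ form G.2.2 d)
    (pre : List AT) (es : List Entry) (mus : List (ℕ × ℕ × ℕ)) (hc : certOK G pre es mus = true)
    (habs : fut.map (fun f => abs f.2) = pre) : False := by
  classical
  unfold certOK at hc
  simp only [Bool.and_eq_true, decide_eq_true_eq, List.all_eq_true] at hc
  obtain ⟨⟨⟨⟨hne, hent⟩, hbal⟩, hpre⟩, htot⟩ := hc
  -- realisation data by position
  set n := fut.length with hn
  have hlen : pre.length = n := by rw [← habs, List.length_map]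
  let dflt : ℤ × RT := (0, (1, ![0, 0, 0, 0]))
  have habsd : abs dflt.2 = D0 := by unfold abs D0; rw [coe_one4]
  let θf : ℕ → ℤ := fun k => (fut.getD k dflt).1
  let pk : ℕ → RT := fun k => (fut.getD k dflt).2
  have hpk : ∀ k, pre.getD k D0 = abs (pk k) := by
    intro k
    rw [← habs, ← habsd, List.getD_map]
  have hmem : ∀ k, k < n → fut.getD k dflt ∈ fut := fun k hk => by
    rw [List.getD_eq_getElem _ _ hk]; exact List.getElem_mem hk
  have hdomk : ∀ k, k < n → IsDominant d v ε (θf k) (pk k) := fun k hk => hdom _ (hmem k hk)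
  have hθ : ∀ k, k + 1 < n → θf k < θf (k + 1) := by
    intro k hk
    have h := List.pairwise_iff_getElem.mp hinc k (k + 1) (by omega) hk (by omega)
    simp only [θf]
    rw [List.getD_eq_getElem _ _ (by omega), List.getD_eq_getElem _ _ hk]
    exact h
  -- competitors
  let qh : Entry → RT := fun e => (toPerm e.2.1.1, e.2.1.2)
  have hqabs : ∀ e ∈ es, abs (qh e) = e.2.1 := by
    intro e he
    obtain ⟨⟨⟨⟨-, -⟩, hS⟩, -⟩, -⟩ := hent e he
    unfold abs; simp only [qh]; rw [coe_toPerm _ hS]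
  have hqpres : ∀ e ∈ es, termSign ε (qh e) ≠ 0 := by
    intro e he
    obtain ⟨⟨⟨⟨-, -⟩, hS⟩, -⟩, hinc'⟩ := hent e he
    refine termSign_ne_zero_of_present ε _ fun b => ?_
    obtain ⟨t, ht, htb⟩ := hinc' b
    rw [← habs] at ht
    obtain ⟨f, hf, rfl⟩ := List.mem_map.mp ht
    simp only [hasInc, abs, decide_eq_true_eq] at htb
    obtain ⟨h1, h2⟩ := htb
    have hp := present_of_termSign_ne_zero ε f.2 (hdom f hf).1 b
    simp only [qh, coe_toPerm _ hS]
    rwa [h1, h2] at hp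
  have hqne : ∀ e ∈ es, qh e ≠ pk e.1 := by
    intro e he h
    obtain ⟨⟨⟨⟨-, hneq⟩, -⟩, -⟩, -⟩ := hent e he
    apply hneq
    rw [hpk, ← h, hqabs e he]
  -- slope differences as forms
  let δS : Entry → ℤ := fun e => form (fun l => histA (pre.getD e.1 D0).2 l - histA e.2.1.2 l) d
  have hδS : ∀ e ∈ es, Summit.ValiantsHypothesis.ValiantsHypothesis.Theorems.LacunarySymmetroidMatrixDescartes.TropicalCensus.slope d (pk e.1) - Summit.ValiantsHypothesis.ValiantsHypothesis.Theorems.LacunarySymmetroidMatrixDescartes.TropicalCensus.slope d (qh e) = δS e := by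
    intro e he
    simp only [δS]
    rw [form_sub, slope_eq_form, slope_eq_form, hpk]
    unfold abs
    rfl
  -- the gaps
  let V : RT → ℤ := fun t => ∑ b, v (t.1 b) b (t.2 b)
  have hgap : ∀ e ∈ es, 1 ≤ θf e.1 * δS e - (V (pk e.1) - V (qh e)) := by
    intro e he
    obtain ⟨⟨⟨⟨hk, -⟩, -⟩, -⟩, -⟩ := hent e he
    have h := bracket d v ε (hdomk e.1 (hlen ▸ hk)) (hqpres e he) (hqne e he)
    rw [← hδS e he]
    simp only [V]
    linarith
  -- the weighted sum of gaps is positive …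
  have hpos : 0 < (es.map fun e => (e.2.2 : ℤ) * (θf e.1 * δS e - (V (pk e.1) - V (qh e)))).sum := by
    apply List.sum_pos
    · intro x hx
      obtain ⟨e, he, rfl⟩ := List.mem_map.mp hx
      obtain ⟨⟨⟨⟨-, -⟩, -⟩, hlam⟩, -⟩ := hent e he
      have : (1 : ℤ) ≤ e.2.2 := by exact_mod_cast hlam
      nlinarith [hgap e he]
    · intro h; apply hne; simpa using h
  -- … its valuation part vanishes by balance …
  have hV : (es.map fun e => (e.2.2 : ℤ) * (V (pk e.1) - V (qh e))).sum = 0 := by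
    have e1 : ∀ e ∈ es, (e.2.2 : ℤ) * (V (pk e.1) - V (qh e)) =
        ∑ x : Fin 4 × Fin 4 × Fin 4, ((e.2.2 : ℤ) * (indI (pre.getD e.1 D0) x - indI e.2.1 x)) * v x.1 x.2.1 x.2.2 := by
      intro e he
      simp only [V]
      rw [val_eq_ind, val_eq_ind, ← hqabs e he, ← hpk, ← Finset.sum_sub_distrib, Finset.mul_sum]
      exact Finset.sum_congr rfl fun x _ => by ring
    rw [List.map_congr_left e1, list_sum_comm]
    refine Finset.sum_eq_zero fun x _ => ?_
    rw [List.sum_map_mul_right]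
    have := hbal x
    unfold coef at this
    rw [this, zero_mul]
  -- … and its slope part is ≤ 0 by summation by parts.
  let E : ℕ → ℤ := fun k => (es.map fun e => if e.1 = k then (e.2.2 : ℤ) * δS e else 0).sum
  have hΘ : (es.map fun e => (e.2.2 : ℤ) * (θf e.1 * δS e)).sum = ∑ k ∈ range n, θf k * E k := by
    have e1 : ∀ e ∈ es, (e.2.2 : ℤ) * (θf e.1 * δS e) =
        ∑ k ∈ range n, (if e.1 = k then θf k * ((e.2.2 : ℤ) * δS e) else 0) := by
      intro e he
      obtain ⟨⟨⟨⟨hk, -⟩, -⟩, -⟩, -⟩ := hent e he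
      rw [Finset.sum_ite_eq, if_pos (mem_range.mpr (hlen ▸ hk))]; ring
    rw [List.map_congr_left e1, list_sum_comm]
    refine Finset.sum_congr rfl fun k _ => ?_
    simp only [E]
    rw [← List.sum_map_mul_left]
    congr 1
    refine List.map_congr_left fun e _ => ?_
    split_ifs <;> ring
  have hP : ∀ j, ∑ k ∈ range (j + 1), E k = form (Hvec pre es j) d := by
    intro j
    have e1 : ∑ k ∈ range (j + 1), E k = (es.map fun e => if e.1 ≤ j then (e.2.2 : ℤ) * δS e else 0).sum := by
      simp only [E]
      rw [← list_sum_comm]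
      congr 1
      refine List.map_congr_left fun e _ => ?_
      rw [Finset.sum_ite_eq]
      simp only [mem_range, Nat.lt_succ_iff]
    rw [e1]
    unfold Hvec
    rw [form_list_sum]
    congr 1
    refine List.map_congr_left fun e _ => ?_
    rw [form_ite]
  have hn1 : 1 ≤ n := by
    rw [← hlen]
    obtain ⟨e, he⟩ := List.exists_mem_of_ne_nil es hne
    obtain ⟨⟨⟨⟨hk, -⟩, -⟩, -⟩, -⟩ := hent e he
    omega
  have habel := Summit.ValiantsHypothesis.ValiantsHypothesis.Theorems.KPlusLogSqLaw.MasterLaw.abel_nonpos (n - 1)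
    (fun k => (θf k : ℚ)) (fun k => (E k : ℚ)) ?_ ?_ ?_
  rotate_left
  · intro k hk; exact_mod_cast (hθ k (by omega)).le
  · intro k hk
    have hj : k < pre.length - 1 := by rw [hlen]; exact hk
    have h := hpre ⟨k, hj⟩
    have : (0 : ℤ) ≤ ∑ i ∈ range (k + 1), E i := by
      rw [hP, h, form_comb]
      have h1 := (mus.getD k (0, 0, 0)).1.cast_nonneg (α := ℤ)
      have h2 := (mus.getD k (0, 0, 0)).2.1.cast_nonneg (α := ℤ)
      have h3 := (mus.getD k (0, 0, 0)).2.2.cast_nonneg (α := ℤ)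
      positivity
    exact_mod_cast this
  · have htot' : Hvec pre es (n - 1) = 0 := by rw [← hlen]; exact htot
    have : ∑ i ∈ range (n - 1 + 1), E i = 0 := by
      rw [hP, htot']; simp [form]
    exact_mod_cast this
  have hΘle : ∑ k ∈ range n, θf k * E k ≤ 0 := by
    have : (∑ k ∈ range (n - 1 + 1), (E k : ℚ) * (θf k : ℚ)) ≤ 0 := habel
    rw [Nat.sub_add_cancel hn1] at this
    have e2 : (∑ k ∈ range n, (E k : ℚ) * (θf k : ℚ)) = ((∑ k ∈ range n, θf k * E k : ℤ) : ℚ) := by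
      push_cast; exact Finset.sum_congr rfl fun k _ => by ring
    rw [e2] at this
    exact_mod_cast this
  -- contradiction
  have hsplit : (es.map fun e => (e.2.2 : ℤ) * (θf e.1 * δS e - (V (pk e.1) - V (qh e)))).sum =
      (es.map fun e => (e.2.2 : ℤ) * (θf e.1 * δS e)).sum - (es.map fun e => (e.2.2 : ℤ) * (V (pk e.1) - V (qh e))).sum := by
    rw [← sum_mul_sub]
  rw [hsplit, hV, hΘ, sub_zero] at hpos
  linarith

end CertSound

/-! ## 3. The search and its soundness -/

/-- all class vectors `Fin 4 → Fin 4`. -/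
def allCls : List (Fin 4 → Fin 4) :=
  (List.finRange 4).flatMap fun a => (List.finRange 4).flatMap fun b => (List.finRange 4).flatMap fun c =>
    (List.finRange 4).map fun e => ![a, b, c, e]

/-- every class vector is listed. -/
theorem mem_allCls (c : Fin 4 → Fin 4) : c ∈ allCls := by
  have h : ![c 0, c 1, c 2, c 3] = c := by funext b; fin_cases b <;> rfl
  rw [← h]
  unfold allCls
  simp only [List.mem_flatMap, List.mem_map, List.mem_finRange, true_and]
  exact ⟨c 0, c 1, c 2, c 3, rfl⟩

/-- candidate abstract terms with a prescribed class-count vector. -/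
def cands (h : Fin 4 → ℤ) : List AT := S3V.flatMap fun σ => (allCls.filter fun c => histA c = h).map fun c => (σ, c)

/-- the abstraction of a real term is a candidate for its own class-count vector. -/
theorem abs_mem_cands (t : RT) : abs t ∈ cands (histA t.2) := by
  unfold cands abs
  simp only [List.mem_flatMap, List.mem_map, List.mem_filter, decide_eq_true_eq]
  exact ⟨⇑t.1, mem_S3V t.1, t.2, ⟨mem_allCls t.2, rfl⟩, rfl⟩

/-- a certificate table row: prefix, entries, facet multipliers. -/
abbrev Cert := List AT × List Entry × List (ℕ × ℕ × ℕ)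

/-- look up and check a certificate for the prefix `pre`. -/
def certFor (G : (Fin 4 → ℤ) × (Fin 4 → ℤ) × (Fin 4 → ℤ)) (tab : List Cert) (pre : List AT) : Bool :=
  tab.any fun c => decide (c.1 = pre) && certOK G pre c.2.1 c.2.2

/-- **refutation search** (pairwise-law dead | certified prefix | refuted recursively), as at `(3,4)`. -/
def refute (Gneg : List (Fin 4 → ℤ)) (G : (Fin 4 → ℤ) × (Fin 4 → ℤ) × (Fin 4 → ℤ)) (tab : List Cert) :
    List AT → List (Fin 4 → ℤ) → Bool
  | _, [] => false
  | asg, h :: rest => (cands h).all fun t =>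
      (asg.any fun a => domL Gneg a t) || certFor G tab (asg ++ [t]) || refute Gneg G tab (asg ++ [t]) rest

section SearchSound
variable (d : Fin 4 → ℕ) (v ε : Fin 4 → Fin 4 → Fin 4 → ℤ) (Gneg : List (Fin 4 → ℤ))
  (G : (Fin 4 → ℤ) × (Fin 4 → ℤ) × (Fin 4 → ℤ)) (tab : List Cert)

/-- **soundness of the search** (as at `(3,4)`). -/
theorem refute_sound (hGneg : ∀ g ∈ Gneg, form g d ≤ 0) (hG1 : 0 ≤ form G.1 d) (hG2 : 0 ≤ form G.2.1 d) (hG3 : 0 ≤ form G.2.2 d) :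
    ∀ (rest : List (Fin 4 → ℤ)) (placed fut : List (ℤ × RT)),
      refute Gneg G tab (placed.map fun a => abs a.2) rest = true →
      List.Forall₂ (fun f h => histA f.2.2 = h) fut rest →
      (∀ a ∈ placed ++ fut, IsDominant d v ε a.1 a.2) → (placed ++ fut).Pairwise (fun a b => a.1 < b.1) → False := by
  intro rest
  induction rest with
  | nil => intro placed fut hs; simp [refute] at hs
  | cons h rest ih =>
    intro placed fut hs hF hdom hpw
    cases hF with
    | cons hfh hrest =>
      rename_i f fut'
      simp only [refute, List.all_eq_true, Bool.or_eq_true, List.any_eq_true] at hs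
      have hcand : abs f.2 ∈ cands h := by rw [← hfh]; exact abs_mem_cands f.2
      have hfmem : f ∈ placed ++ f :: fut' := List.mem_append_right _ List.mem_cons_self
      rcases hs (abs f.2) hcand with (⟨a, ha, hdomL⟩ | hcert) | hrec
      · -- pairwise law against a placed term
        obtain ⟨a', ha', rfl⟩ := List.mem_map.mp ha
        have hlt : a'.1 < f.1 := by
          have hsub : [a', f].Sublist (placed ++ f :: fut') := by
            have h1 : [a'].Sublist placed := List.singleton_sublist.mpr ha'
            have h2 : [f].Sublist (f :: fut') := List.singleton_sublist.mpr List.mem_cons_self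
            exact h1.append h2
          have := hpw.sublist hsub
          simp only [List.pairwise_cons, List.mem_singleton, forall_eq] at this
          exact this.1
        exact domL_sound d v ε Gneg hGneg hlt a'.2 f.2 (hdom a' (List.mem_append_left _ ha')) (hdom f hfmem) hdomL
      · -- a certified prefix
        unfold certFor at hcert
        rw [List.any_eq_true] at hcert
        obtain ⟨c, -, hc⟩ := hcert
        rw [Bool.and_eq_true, decide_eq_true_eq] at hc
        obtain ⟨hc1, hc2⟩ := hc
        refine cert_sound_four d v ε (placed ++ [f]) ?_ ?_ G hG1 hG2 hG3 _ c.2.1 c.2.2 hc2 (by simp)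
        · intro a ha
          apply hdom
          rcases List.mem_append.mp ha with ha | ha
          · exact List.mem_append_left _ ha
          · rw [List.mem_singleton] at ha; subst ha; exact hfmem
        · exact hpw.sublist (by simp)
      · -- recurse
        refine ih (placed ++ [f]) fut' (by simpa using hrec) hrest ?_ ?_
        · intro a ha; apply hdom; simpa using ha
        · simpa using hpw

/-- corollary with nothing placed. -/
theorem not_realised_of_refute (hGneg : ∀ g ∈ Gneg, form g d ≤ 0) (hG1 : 0 ≤ form G.1 d) (hG2 : 0 ≤ form G.2.1 d)
    (hG3 : 0 ≤ form G.2.2 d) (pat : List (Fin 4 → ℤ)) (hs : refute Gneg G tab [] pat = true) (fut : List (ℤ × RT))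
    (hF : List.Forall₂ (fun f h => histA f.2.2 = h) fut pat) (hdom : ∀ a ∈ fut, IsDominant d v ε a.1 a.2)
    (hpw : fut.Pairwise (fun a b => a.1 < b.1)) : False :=
  refute_sound d v ε Gneg G tab hGneg hG1 hG2 hG3 pat [] fut (by simpa using hs) hF (by simpa using hdom) (by simpa using hpw)

/-- first pattern term restricted to the identity permutation vector. -/
def refute1 (Gneg : List (Fin 4 → ℤ)) (G : (Fin 4 → ℤ) × (Fin 4 → ℤ) × (Fin 4 → ℤ)) (tab : List Cert) :
    List (Fin 4 → ℤ) → Bool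
  | [] => false
  | h :: rest => (allCls.filter fun c => histA c = h).all fun c =>
      certFor G tab [(![0, 1, 2, 3], c)] || refute Gneg G tab [(![0, 1, 2, 3], c)] rest

/-- **a pattern refuted by `refute1` is realised by no dominant family** (rows relabelled; `isDominant_relabel_iff`). -/
theorem not_realised_of_refute1 (hGneg : ∀ g ∈ Gneg, form g d ≤ 0) (hG1 : 0 ≤ form G.1 d) (hG2 : 0 ≤ form G.2.1 d)
    (hG3 : 0 ≤ form G.2.2 d) (pat : List (Fin 4 → ℤ)) (hs : refute1 Gneg G tab pat = true) (fut : List (ℤ × RT))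
    (hF : List.Forall₂ (fun f h => histA f.2.2 = h) fut pat) (hdom : ∀ a ∈ fut, IsDominant d v ε a.1 a.2)
    (hpw : fut.Pairwise (fun a b => a.1 < b.1)) : False := by
  classical
  cases hF with
  | nil => simp [refute1] at hs
  | cons hfh hrest =>
    rename_i f h fut' rest
    -- relabel the rows by the permutation of the first term
    set π : Equiv.Perm (Fin 4) := f.2.1 with hπ
    let v' : Fin 4 → Fin 4 → Fin 4 → ℤ := fun a b l => v (π a) b l
    let ε' : Fin 4 → Fin 4 → Fin 4 → ℤ := fun a b l => ε (π a) b l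
    let rl : ℤ × RT → ℤ × RT := fun a => (a.1, (π⁻¹ * a.2.1, a.2.2))
    have hdom' : ∀ a ∈ f :: fut', IsDominant d v' ε' a.1 (rl a).2 := by
      intro a ha
      have hrel := (isDominant_relabel_iff d v ε π 1 (π⁻¹ * a.2.1, a.2.2) a.1).mp
      have e : ((π * (π⁻¹ * a.2.1) * (1 : Equiv.Perm (Fin 4))⁻¹ : Equiv.Perm (Fin 4)),
          fun j => a.2.2 (((1 : Equiv.Perm (Fin 4))⁻¹) j)) = a.2 := by
        ext1
        · ext1 x; simp
        · funext j; simp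
      rw [e] at hrel
      simpa [v', ε'] using hrel (hdom a ha)
    simp only [refute1, List.all_eq_true, Bool.or_eq_true, List.mem_filter, decide_eq_true_eq] at hs
    have hs' := hs f.2.2 ⟨mem_allCls _, hfh⟩
    have habs1 : [(![0, 1, 2, 3], f.2.2)] = [rl f].map fun a => abs a.2 := by
      simp only [List.map_cons, List.map_nil, abs, rl]
      rw [hπ, inv_mul_cancel, coe_one4]
    have hfut' : ∀ a ∈ fut', IsDominant d v' ε' (rl a).1 (rl a).2 := fun a ha => hdom' a (List.mem_cons_of_mem _ ha)
    have hpw' : (List.map rl (f :: fut')).Pairwise (fun a b => a.1 < b.1) := by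
      rw [List.pairwise_map]; exact hpw
    rcases hs' with hcert | hrec
    · unfold certFor at hcert
      rw [List.any_eq_true] at hcert
      obtain ⟨c, -, hc⟩ := hcert
      rw [Bool.and_eq_true, decide_eq_true_eq] at hc
      obtain ⟨hc1, hc2⟩ := hc
      refine cert_sound_four d v' ε' [rl f] ?_ (List.pairwise_singleton _ _) G hG1 hG2 hG3 _ c.2.1 c.2.2 hc2 habs1.symm
      intro a ha; rw [List.mem_singleton] at ha; subst ha; exact hdom' f List.mem_cons_self
    · rw [habs1] at hrec
      refine refute_sound d v' ε' Gneg G tab hGneg hG1 hG2 hG3 rest [rl f] (fut'.map rl) hrec ?_ ?_ ?_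
      · exact List.forall₂_map_left_iff.mpr (by simpa [rl] using hrest)
      · intro a ha
        rcases List.mem_append.mp ha with ha | ha
        · rw [List.mem_singleton] at ha; subst ha; exact hdom' f List.mem_cons_self
        · obtain ⟨a', ha', rfl⟩ := List.mem_map.mp ha; exact hfut' a' ha'
      · simpa using hpw'

end SearchSound

/-! ## 4. Splitting a large certificate table (monotonicity in the table, branchwise assembly) -/

section Split
variable (Gneg : List (Fin 4 → ℤ)) (G : (Fin 4 → ℤ) × (Fin 4 → ℤ) × (Fin 4 → ℤ))
/-- a certificate found in a table is found in any longer table. -/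
theorem certFor_append (tab tab' : List Cert) (pre : List AT) (h : certFor G tab pre = true) : certFor G (tab ++ tab') pre = true := by
  unfold certFor at *
  rw [List.any_eq_true] at *
  obtain ⟨c, hc, hcc⟩ := h
  exact ⟨c, List.mem_append_left _ hc, hcc⟩
/-- left-extension version. -/
theorem certFor_append_left (tab tab' : List Cert) (pre : List AT) (h : certFor G tab pre = true) :
    certFor G (tab' ++ tab) pre = true := by
  unfold certFor at *
  rw [List.any_eq_true] at *
  obtain ⟨c, hc, hcc⟩ := h
  exact ⟨c, List.mem_append_right _ hc, hcc⟩
/-- **the search is monotone in the table.** -/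
theorem refute_mono (tab tab' : List Cert) (hsub : ∀ pre, certFor G tab pre = true → certFor G tab' pre = true) :
    ∀ (rest : List (Fin 4 → ℤ)) (asg : List AT), refute Gneg G tab asg rest = true → refute Gneg G tab' asg rest = true := by
  intro rest
  induction rest with
  | nil => intro asg h; simp [refute] at h
  | cons h rest ih =>
    intro asg hs
    simp only [refute, List.all_eq_true, Bool.or_eq_true] at hs ⊢
    intro t ht
    rcases hs t ht with (h1 | h2) | h3
    · exact Or.inl (Or.inl h1)
    · exact Or.inl (Or.inr (hsub _ h2))
    · exact Or.inr (ih _ h3)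
/-- **branchwise assembly**: if every candidate for the next histogram is pairwise-law dead, certified, or refuted, the node is refuted. -/
theorem refute_cons_of_forall (tab : List Cert) (asg : List AT) (h : Fin 4 → ℤ) (rest : List (Fin 4 → ℤ))
    (hall : ∀ t ∈ cands h, (asg.any fun a => domL Gneg a t) = true ∨ certFor G tab (asg ++ [t]) = true ∨
      refute Gneg G tab (asg ++ [t]) rest = true) :
    refute Gneg G tab asg (h :: rest) = true := by
  simp only [refute, List.all_eq_true, Bool.or_eq_true]
  intro t ht
  rcases hall t ht with h1 | h2 | h3
  · exact Or.inl (Or.inl h1)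
  · exact Or.inl (Or.inr h2)
  · exact Or.inr h3
/-- the relabelled search from its single first branch (the first histogram has exactly one class vector). -/
theorem refute1_of_refute (tab : List Cert) (c : Fin 4 → Fin 4) (h : Fin 4 → ℤ) (rest : List (Fin 4 → ℤ))
    (hc : (allCls.filter fun c' => histA c' = h) = [c]) (hr : refute Gneg G tab [(![0, 1, 2, 3], c)] rest = true) :
    refute1 Gneg G tab (h :: rest) = true := by
  simp only [refute1, hc, List.all_cons, List.all_nil, Bool.and_true, Bool.or_eq_true]
  exact Or.inr hr

end Split

end FourFourCore

end Summit.ValiantsHypothesis.ValiantsHypothesis.Theorems.KPlusLogSqLaw
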